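import Summits.RiemannHypothesis.RiemannHypothesis.Theorems.Splittings.RobinFiniteDensityTwoLayer

/-!
# RobinFiniteRefl — the REFLECTION PAIRING `ρ ↦ 1 − ρ̄` of the off-line zero sum (SPLIT-robin-finite gen 14, part 1/4; RH-free)

Cell rh-split, card `cards/SPLIT-robin-finite.md` §21.  HONEST LABEL: «SPLITTING SEARCH over kernel-typed RH-EQUIVALENCES; a splitting A ∧ B ⟹ RH is CONDITIONAL bookkeeping unless A and B
are both proved; nothing here bears on the truth of RH.»

Every consumer of the off-line zero sum `Σ_{|γ|>T} m(ρ)·x^{β−1/2}/γ²` in the Robin/CA exchange engine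
(`RobinFiniteE1c.offLineSumAt_of_zeroTailBound`, `RobinFiniteDensityTwoLayer.offLine_le_twoLayer`) bounds `x^{β−1/2} ≤ √x`
(resp. `≤ x^{2/5}` for `β < 0.9`) zero by zero.  The zero set is invariant under `ρ ↦ 1 − ρ̄` (functional equation +
conjugation; `FordL33.reflEquiv`, `refl_re`, `order_refl`), which fixes `|γ|` and the multiplicity and sends `β ↦ 1 − β`; pairing
each zero with its mirror gives the EXACT identity `offLine_eq_tsum_symm` and hence, for `x ≥ 1`, the charge per unit of
`Σ m/γ²` is `(√x + 1/√x)/2` (tail layer, `offLineSumAt_refl_of_zeroTailBound`) and `(x^{2/5} + x^{−2/5})/2` (layer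
`0.1 < β < 0.9`, `offLine_le_twoLayer_refl`) — HALF of what the engine pays, with no hypothesis added.
-/

set_option linter.dupNamespace false

noncomputable section

open Real Filter Finset
open scoped Chebyshev ComplexConjugate

namespace Summit.RiemannHypothesis.RiemannHypothesis.Theorems.Splittings.RobinFiniteC1

open Literature.NumberTheory.LFunctions Literature.NumberTheory.DiophantineGeometry
open Literature.NumberTheory.LFunctions.SchoenfeldBound
open Literature.NumberTheory.LFunctions.NicolasJExplicit
open RobinAnalyticSharp RobinAnalyticSharp.Cells
open Summit.RiemannHypothesis.RiemannHypothesis.Theorems.Splittings.RobinFiniteE3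
open Summit.RiemannHypothesis.RiemannHypothesis.Theorems.Splittings.RobinFiniteTail
  (zeroTailBound_tailH tailH_PT_le tailH_nonneg tailH_1e5_le)
open Summit.RiemannHypothesis.RiemannHypothesis.Theorems.Splittings.RobinFiniteE1c (summable_tailTerm)

section Reflection

/-! ### R0 · RH-free: the reflection pairing of the off-line zero sum -/

/-- `x^u + x^{−u} ≤ x^a + x^{−a}` for `x ≥ 1` and `|u| ≤ a` (`x^v + x^{−v} = 2·cosh(v·log x)`, `cosh` is even and increasing in `|·|`). -/
theorem rpow_add_rpow_neg_le {x u a : ℝ} (hx : 1 ≤ x) (hu : |u| ≤ a) :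
    x ^ u + x ^ (-u) ≤ x ^ a + x ^ (-a) := by
  have hx0 : 0 < x := by linarith
  have hL : 0 ≤ Real.log x := Real.log_nonneg hx
  have key : ∀ v : ℝ, x ^ v + x ^ (-v) = 2 * Real.cosh (v * Real.log x) := by
    intro v
    have e1 : Real.log x * v = v * Real.log x := mul_comm _ _
    have e2 : Real.log x * -v = -(v * Real.log x) := by ring
    rw [Real.cosh_eq, Real.rpow_def_of_pos hx0, Real.rpow_def_of_pos hx0, e1, e2]
    ring
  rw [key u, key a]
  have h : |u * Real.log x| ≤ |a * Real.log x| := by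
    rw [abs_mul, abs_mul, abs_of_nonneg hL]
    exact mul_le_mul_of_nonneg_right (hu.trans (le_abs_self a)) hL
  have := Real.cosh_le_cosh.2 h
  linarith

/-- `Im(1 − ρ̄) = Im ρ`. -/
theorem refl_im (ρ : RHWave0.riemannZetaNontrivialZeros) :
    ((FordL33.refl ρ : RHWave0.riemannZetaNontrivialZeros) : ℂ).im = (ρ : ℂ).im := by
  simp [FordL33.refl]

/-- Summability of the weighted off-line summand at `x ≥ 1` (`x^{β−1/2} ≤ √x`; the tree's `summable_tailTerm`). -/
theorem summable_offLineTerm (T : ℝ) {x : ℝ} (hx : 1 ≤ x) :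
    Summable fun ρ : RHWave0.riemannZetaNontrivialZeros =>
      (if T < |(ρ : ℂ).im| then
        (riemannZetaZeroOrder (ρ : ℂ) : ℝ) * x ^ ((ρ : ℂ).re - 1 / 2) / (ρ : ℂ).im ^ 2 else 0) := by
  have hx0 : 0 ≤ x := by linarith
  refine ((summable_tailTerm T).mul_left (√x)).of_nonneg_of_le (fun ρ => ?_) (fun ρ => ?_)
  · split_ifs
    · exact div_nonneg (mul_nonneg (zeroOrder_nonneg' ρ) (Real.rpow_nonneg hx0 _)) (sq_nonneg _)
    · exact le_rfl
  · split_ifs with hT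
    · have hm := zeroOrder_nonneg' ρ
      have hre1 := (ZetaZeros.riemannZetaNontrivialZeros.re_lt_one ρ.2).le
      have hpow : x ^ ((ρ : ℂ).re - 1 / 2) ≤ √x := by
        rw [Real.sqrt_eq_rpow]; exact Real.rpow_le_rpow_of_exponent_le hx (by linarith)
      calc (riemannZetaZeroOrder (ρ : ℂ) : ℝ) * x ^ ((ρ : ℂ).re - 1 / 2) / (ρ : ℂ).im ^ 2
          ≤ (riemannZetaZeroOrder (ρ : ℂ) : ℝ) * √x / (ρ : ℂ).im ^ 2 :=
            div_le_div_of_nonneg_right (mul_le_mul_of_nonneg_left hpow hm) (sq_nonneg _)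
        _ = √x * ((riemannZetaZeroOrder (ρ : ℂ) : ℝ) / (ρ : ℂ).im ^ 2) := by ring
    · simp

/-- **THE REFLECTION PAIRING (RH-free, exact).**  `ρ ↦ 1 − ρ̄` permutes the non-trivial zeros (`FordL33.reflEquiv`), fixes
`Im ρ` and `m(ρ)` (`order_refl`) and sends `Re ρ ↦ 1 − Re ρ` (`refl_re`); summing `f(ρ) = f(1 − ρ̄)` over the permutation:
`Σ_{|γ|>T} m·x^{β−1/2}/γ² = Σ_{|γ|>T} m·((x^{β−1/2} + x^{−(β−1/2)})/2)/γ²` (`= Σ m·cosh((β−½)log x)/γ²`), every `x ≥ 1`, every `T`. -/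
theorem offLine_eq_tsum_symm (T : ℝ) {x : ℝ} (hx : 1 ≤ x) :
    ∑' ρ : RHWave0.riemannZetaNontrivialZeros,
        (if T < |(ρ : ℂ).im| then
          (riemannZetaZeroOrder (ρ : ℂ) : ℝ) * x ^ ((ρ : ℂ).re - 1 / 2) / (ρ : ℂ).im ^ 2 else 0) =
      ∑' ρ : RHWave0.riemannZetaNontrivialZeros,
        (if T < |(ρ : ℂ).im| then
          (riemannZetaZeroOrder (ρ : ℂ) : ℝ) * ((x ^ ((ρ : ℂ).re - 1 / 2) + x ^ (-((ρ : ℂ).re - 1 / 2))) / 2) /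
            (ρ : ℂ).im ^ 2 else 0) := by
  set f : RHWave0.riemannZetaNontrivialZeros → ℝ := fun ρ =>
    if T < |(ρ : ℂ).im| then (riemannZetaZeroOrder (ρ : ℂ) : ℝ) * x ^ ((ρ : ℂ).re - 1 / 2) / (ρ : ℂ).im ^ 2 else 0
    with hf
  have hSf : Summable f := summable_offLineTerm T hx
  have hrefl : ∀ ρ : RHWave0.riemannZetaNontrivialZeros, f (FordL33.refl ρ) =
      if T < |(ρ : ℂ).im| then
        (riemannZetaZeroOrder (ρ : ℂ) : ℝ) * x ^ (-((ρ : ℂ).re - 1 / 2)) / (ρ : ℂ).im ^ 2 else 0 := by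
    intro ρ
    have e : (1 - (ρ : ℂ).re) - 1 / 2 = -((ρ : ℂ).re - 1 / 2) := by ring
    simp only [hf]
    rw [refl_im, FordL33.refl_re, FordL33.order_refl, e]
  have hSf' : Summable (fun ρ => f (FordL33.refl ρ)) := by
    have h := (FordL33.reflEquiv.summable_iff (f := f)).2 hSf
    simpa only [Function.comp_def, FordL33.reflEquiv, Function.Involutive.coe_toPerm] using h
  have hperm : ∑' ρ, f (FordL33.refl ρ) = ∑' ρ, f ρ := by
    have h := Equiv.tsum_eq FordL33.reflEquiv f
    simpa only [FordL33.reflEquiv, Function.Involutive.coe_toPerm] using h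
  have h2 : 2 * ∑' ρ, f ρ = ∑' ρ, (f ρ + f (FordL33.refl ρ)) := by
    rw [hSf.tsum_add hSf', hperm]; ring
  have h3 : ∑' ρ, f ρ = ∑' ρ, (f ρ + f (FordL33.refl ρ)) / 2 := by
    rw [tsum_div_const, ← h2]; ring
  rw [h3]
  refine tsum_congr fun ρ => ?_
  rw [hrefl ρ]
  simp only [hf]
  split_ifs <;> ring

/-- **R0a · the tail-only off-line bound, HALVED (RH-free).**  A tail bound `Σ_{|γ|>T} m/γ² ≤ h` gives
`Σ_{|γ|>T} m·x^{β−1/2}/γ² ≤ h·(√x + 1/√x)/2` at every `x ≥ 1` (tree, unpaired: `h·√x`, `offLineSumAt_of_zeroTailBound`):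
`0 < β < 1` gives `|β − ½| ≤ ½`, so the paired charge is `(x^{β−½} + x^{½−β})/2 ≤ (√x + 1/√x)/2`. -/
theorem offLineSumAt_refl_of_zeroTailBound {T h x : ℝ}
    (ht : ∑' ρ : RHWave0.riemannZetaNontrivialZeros,
        (if T < |(ρ : ℂ).im| then (riemannZetaZeroOrder (ρ : ℂ) : ℝ) / (ρ : ℂ).im ^ 2 else 0) ≤ h)
    (hx : 1 ≤ x) :
    ∑' ρ : RHWave0.riemannZetaNontrivialZeros,
      (if T < |(ρ : ℂ).im| then
        (riemannZetaZeroOrder (ρ : ℂ) : ℝ) * x ^ ((ρ : ℂ).re - 1 / 2) / (ρ : ℂ).im ^ 2 else 0) ≤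
      h * ((√x + (√x)⁻¹) / 2) := by
  rw [offLine_eq_tsum_symm T hx]
  have hx0 : 0 < x := by linarith
  have hS := summable_tailTerm T
  have hB0 : 0 ≤ (√x + (√x)⁻¹) / 2 := by positivity
  have hpair : ∀ ρ : RHWave0.riemannZetaNontrivialZeros,
      x ^ ((ρ : ℂ).re - 1 / 2) + x ^ (-((ρ : ℂ).re - 1 / 2)) ≤ √x + (√x)⁻¹ := by
    intro ρ
    have hre0 := ZetaZeros.riemannZetaNontrivialZeros.re_pos ρ.2
    have hre1 := ZetaZeros.riemannZetaNontrivialZeros.re_lt_one ρ.2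
    have h1 : |(ρ : ℂ).re - 1 / 2| ≤ 1 / 2 := abs_le.2 ⟨by linarith, by linarith⟩
    have h2 := rpow_add_rpow_neg_le hx h1
    have e1 : x ^ (-(1 / 2 : ℝ)) = (√x)⁻¹ := by rw [Real.rpow_neg hx0.le, Real.sqrt_eq_rpow]
    have e2 : x ^ (1 / 2 : ℝ) = √x := (Real.sqrt_eq_rpow x).symm
    rw [e1] at h2; rw [e2] at h2
    exact h2
  have hle : ∀ ρ : RHWave0.riemannZetaNontrivialZeros,
      (if T < |(ρ : ℂ).im| then
          (riemannZetaZeroOrder (ρ : ℂ) : ℝ) * ((x ^ ((ρ : ℂ).re - 1 / 2) + x ^ (-((ρ : ℂ).re - 1 / 2))) / 2) /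
            (ρ : ℂ).im ^ 2 else 0) ≤
        (√x + (√x)⁻¹) / 2 * (if T < |(ρ : ℂ).im| then (riemannZetaZeroOrder (ρ : ℂ) : ℝ) / (ρ : ℂ).im ^ 2 else 0) := by
    intro ρ
    split_ifs with hT
    · have hm := zeroOrder_nonneg' ρ
      have h1 : (riemannZetaZeroOrder (ρ : ℂ) : ℝ) * ((x ^ ((ρ : ℂ).re - 1 / 2) + x ^ (-((ρ : ℂ).re - 1 / 2))) / 2) ≤
          (riemannZetaZeroOrder (ρ : ℂ) : ℝ) * ((√x + (√x)⁻¹) / 2) :=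
        mul_le_mul_of_nonneg_left (by linarith [hpair ρ]) hm
      calc (riemannZetaZeroOrder (ρ : ℂ) : ℝ) * ((x ^ ((ρ : ℂ).re - 1 / 2) + x ^ (-((ρ : ℂ).re - 1 / 2))) / 2) /
            (ρ : ℂ).im ^ 2
          ≤ (riemannZetaZeroOrder (ρ : ℂ) : ℝ) * ((√x + (√x)⁻¹) / 2) / (ρ : ℂ).im ^ 2 :=
            div_le_div_of_nonneg_right h1 (sq_nonneg _)
        _ = (√x + (√x)⁻¹) / 2 * ((riemannZetaZeroOrder (ρ : ℂ) : ℝ) / (ρ : ℂ).im ^ 2) := by ring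
    · simp
  have hnn : ∀ ρ : RHWave0.riemannZetaNontrivialZeros,
      0 ≤ (if T < |(ρ : ℂ).im| then
          (riemannZetaZeroOrder (ρ : ℂ) : ℝ) * ((x ^ ((ρ : ℂ).re - 1 / 2) + x ^ (-((ρ : ℂ).re - 1 / 2))) / 2) /
            (ρ : ℂ).im ^ 2 else 0) := by
    intro ρ
    split_ifs
    · exact div_nonneg (mul_nonneg (zeroOrder_nonneg' ρ)
        (by positivity)) (sq_nonneg _)
    · exact le_rfl
  have hS' := (hS.mul_left ((√x + (√x)⁻¹) / 2)).of_nonneg_of_le hnn hle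
  calc ∑' ρ : RHWave0.riemannZetaNontrivialZeros,
        (if T < |(ρ : ℂ).im| then
          (riemannZetaZeroOrder (ρ : ℂ) : ℝ) * ((x ^ ((ρ : ℂ).re - 1 / 2) + x ^ (-((ρ : ℂ).re - 1 / 2))) / 2) /
            (ρ : ℂ).im ^ 2 else 0)
      ≤ ∑' ρ : RHWave0.riemannZetaNontrivialZeros,
          (√x + (√x)⁻¹) / 2 * (if T < |(ρ : ℂ).im| then (riemannZetaZeroOrder (ρ : ℂ) : ℝ) / (ρ : ℂ).im ^ 2 else 0) :=
        hS'.tsum_le_tsum hle (hS.mul_left _)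
    _ = (√x + (√x)⁻¹) / 2 * ∑' ρ : RHWave0.riemannZetaNontrivialZeros,
          (if T < |(ρ : ℂ).im| then (riemannZetaZeroOrder (ρ : ℂ) : ℝ) / (ρ : ℂ).im ^ 2 else 0) := tsum_mul_left
    _ ≤ (√x + (√x)⁻¹) / 2 * h := mul_le_mul_of_nonneg_left ht hB0
    _ = h * ((√x + (√x)⁻¹) / 2) := mul_comm _ _


/-- **R0b · the two-layer off-line bound, HALVED (RH-free).**  For `T ≥ 3·10¹²`, `N(0.9, t) ≤ 1300√t` (`t ≥ 3·10¹²`) and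
`x ≥ 1`: `Σ_{|γ|>T} m·x^{β−1/2}/γ² ≤ ((x^{2/5} + x^{−2/5})/2)·tailH(T) + (√x + 1/√x)·(16/7)·2600/(T√T)` (tree, unpaired:
`x^{2/5}·tailH(T) + √x·S(T)`, `offLine_le_twoLayer`).  After pairing, a zero with `0.1 < β < 0.9` has `|β − ½| < 2/5`, so its
paired charge is `≤ (x^{2/5} + x^{−2/5})/2`; a zero with `β ≥ 0.9` OR `β ≤ 0.1` is charged `(√x + 1/√x)/2`, and the zeros with
`β ≤ 0.1` are the mirror images of those with `β ≥ 0.9`, so both classes are counted by the same density sum `S(T)` (`sum_densTerm_le`). -/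
theorem offLine_le_twoLayer_refl {T x : ℝ} (hT : 3 * (10 : ℝ) ^ 12 ≤ T)
    (hN : ∀ t : ℝ, 3 * (10 : ℝ) ^ 12 ≤ t → (zetaZeroCountRe 0.9 t : ℝ) ≤ 1300 * √t) (hx : 1 ≤ x) :
    ∑' ρ : RHWave0.riemannZetaNontrivialZeros,
        (if T < |(ρ : ℂ).im| then
          (riemannZetaZeroOrder (ρ : ℂ) : ℝ) * x ^ ((ρ : ℂ).re - 1 / 2) / (ρ : ℂ).im ^ 2 else 0) ≤
      (x ^ (2 / 5 : ℝ) + x ^ (-(2 / 5) : ℝ)) / 2 *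
          ((Real.log (T / (2 * π)) + 1) / (π * T) + (184 + 30 * Real.log T) / T ^ 2) +
        (√x + (√x)⁻¹) * (16 / 7 * (2600 / (T * √T))) := by
  rw [offLine_eq_tsum_symm T hx]
  set tail : RHWave0.riemannZetaNontrivialZeros → ℝ := fun ρ =>
    if T < |(ρ : ℂ).im| then (riemannZetaZeroOrder (ρ : ℂ) : ℝ) / (ρ : ℂ).im ^ 2 else 0 with htail
  set dens : RHWave0.riemannZetaNontrivialZeros → ℝ := fun ρ =>
    if T < |(ρ : ℂ).im| ∧ (0.9 : ℝ) ≤ (ρ : ℂ).re then (riemannZetaZeroOrder (ρ : ℂ) : ℝ) / (ρ : ℂ).im ^ 2 else 0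
    with hdens
  set densR : RHWave0.riemannZetaNontrivialZeros → ℝ := fun ρ =>
    if T < |(ρ : ℂ).im| ∧ (ρ : ℂ).re ≤ 0.1 then (riemannZetaZeroOrder (ρ : ℂ) : ℝ) / (ρ : ℂ).im ^ 2 else 0
    with hdensR
  set A : ℝ := (x ^ (2 / 5 : ℝ) + x ^ (-(2 / 5) : ℝ)) / 2 with hA_def
  set B : ℝ := (√x + (√x)⁻¹) / 2 with hB_def
  have hT7 : (7 : ℝ) ≤ T := le_trans (by norm_num) hT
  have hx0 : 0 < x := by linarith
  have hA0 : 0 ≤ A := by positivity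
  have hB0 : 0 ≤ B := by positivity
  have hStail : Summable tail := summable_tailTerm T
  have htail_nn : ∀ ρ, 0 ≤ tail ρ := fun ρ => by
    simp only [htail]
    split_ifs
    · exact div_nonneg (zeroOrder_nonneg' ρ) (sq_nonneg _)
    · exact le_rfl
  have hdens_nn : ∀ ρ, 0 ≤ dens ρ := fun ρ => by
    simp only [hdens]
    split_ifs
    · exact div_nonneg (zeroOrder_nonneg' ρ) (sq_nonneg _)
    · exact le_rfl
  have hdensR_nn : ∀ ρ, 0 ≤ densR ρ := fun ρ => by
    simp only [hdensR]
    split_ifs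
    · exact div_nonneg (zeroOrder_nonneg' ρ) (sq_nonneg _)
    · exact le_rfl
  have hdens_le : ∀ ρ, dens ρ ≤ tail ρ := fun ρ => by
    simp only [hdens, htail]
    by_cases h1 : T < |(ρ : ℂ).im|
    · by_cases h2 : (0.9 : ℝ) ≤ (ρ : ℂ).re
      · rw [if_pos ⟨h1, h2⟩, if_pos h1]
      · rw [if_neg (fun h => h2 h.2), if_pos h1]
        exact div_nonneg (zeroOrder_nonneg' ρ) (sq_nonneg _)
    · rw [if_neg (fun h => h1 h.1), if_neg h1]
  have hdensR_le : ∀ ρ, densR ρ ≤ tail ρ := fun ρ => by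
    simp only [hdensR, htail]
    by_cases h1 : T < |(ρ : ℂ).im|
    · by_cases h2 : (ρ : ℂ).re ≤ 0.1
      · rw [if_pos ⟨h1, h2⟩, if_pos h1]
      · rw [if_neg (fun h => h2 h.2), if_pos h1]
        exact div_nonneg (zeroOrder_nonneg' ρ) (sq_nonneg _)
    · rw [if_neg (fun h => h1 h.1), if_neg h1]
  have hSdens : Summable dens := hStail.of_nonneg_of_le hdens_nn hdens_le
  have hSdensR : Summable densR := hStail.of_nonneg_of_le hdensR_nn hdensR_le
  -- the mirror class `β ≤ 0.1` is the reflection of the class `β ≥ 0.9`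
  have hdens_refl : ∀ ρ, dens (FordL33.refl ρ) = densR ρ := fun ρ => by
    simp only [hdens, hdensR]
    rw [refl_im, FordL33.refl_re, FordL33.order_refl]
    by_cases h1 : T < |(ρ : ℂ).im|
    · by_cases h2 : (ρ : ℂ).re ≤ 0.1
      · have h2' : (0.9 : ℝ) ≤ 1 - (ρ : ℂ).re := by linarith
        rw [if_pos ⟨h1, h2'⟩, if_pos ⟨h1, h2⟩]
      · have h2' : ¬ (0.9 : ℝ) ≤ 1 - (ρ : ℂ).re := fun h => h2 (by linarith)
        rw [if_neg (fun h => h2' h.2), if_neg (fun h => h2 h.2)]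
    · rw [if_neg (fun h => h1 h.1), if_neg (fun h => h1 h.1)]
  have hdensR_sum_eq : ∑' ρ, densR ρ = ∑' ρ, dens ρ := by
    have h := Equiv.tsum_eq FordL33.reflEquiv dens
    simp only [FordL33.reflEquiv, Function.Involutive.coe_toPerm, hdens_refl] at h
    exact h
  have htail_sum : ∑' ρ, tail ρ ≤ (Real.log (T / (2 * π)) + 1) / (π * T) + (184 + 30 * Real.log T) / T ^ 2 :=
    zeroTailBound_tailH hT7
  have hdens_sum : ∑' ρ, dens ρ ≤ 16 / 7 * (2600 / (T * √T)) :=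
    Real.tsum_le_of_sum_le (fun ρ => hdens_nn ρ) fun s => sum_densTerm_le hT hN s
  -- the paired charges
  have e1 : x ^ (-(1 / 2 : ℝ)) = (√x)⁻¹ := by rw [Real.rpow_neg hx0.le, Real.sqrt_eq_rpow]
  have e2 : x ^ (1 / 2 : ℝ) = √x := (Real.sqrt_eq_rpow x).symm
  have hpairB : ∀ ρ : RHWave0.riemannZetaNontrivialZeros,
      (x ^ ((ρ : ℂ).re - 1 / 2) + x ^ (-((ρ : ℂ).re - 1 / 2))) / 2 ≤ B := by
    intro ρ
    have hre0 := ZetaZeros.riemannZetaNontrivialZeros.re_pos ρ.2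
    have hre1 := ZetaZeros.riemannZetaNontrivialZeros.re_lt_one ρ.2
    have h1 : |(ρ : ℂ).re - 1 / 2| ≤ 1 / 2 := abs_le.2 ⟨by linarith, by linarith⟩
    have h2 := rpow_add_rpow_neg_le hx h1
    rw [e1] at h2; rw [e2] at h2
    rw [hB_def]; linarith
  have hpairA : ∀ ρ : RHWave0.riemannZetaNontrivialZeros, (0.1 : ℝ) < (ρ : ℂ).re → (ρ : ℂ).re < 0.9 →
      (x ^ ((ρ : ℂ).re - 1 / 2) + x ^ (-((ρ : ℂ).re - 1 / 2))) / 2 ≤ A := by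
    intro ρ hlo hhi
    have h1 : |(ρ : ℂ).re - 1 / 2| ≤ 2 / 5 := abs_le.2 ⟨by linarith, by linarith⟩
    have h2 := rpow_add_rpow_neg_le hx h1
    rw [hA_def]
    have e3 : x ^ (-(2 / 5) : ℝ) = x ^ (-(2 / 5 : ℝ)) := by norm_num
    rw [e3]; linarith
  -- pointwise comparison of the paired summand with `A·tail + B·(dens + densR)`
  have hpt : ∀ ρ : RHWave0.riemannZetaNontrivialZeros,
      (if T < |(ρ : ℂ).im| then
          (riemannZetaZeroOrder (ρ : ℂ) : ℝ) * ((x ^ ((ρ : ℂ).re - 1 / 2) + x ^ (-((ρ : ℂ).re - 1 / 2))) / 2) /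
            (ρ : ℂ).im ^ 2 else 0) ≤
        A * tail ρ + B * (dens ρ + densR ρ) := by
    intro ρ
    simp only [htail, hdens, hdensR]
    have hm := zeroOrder_nonneg' ρ
    have hγ := sq_nonneg ((ρ : ℂ).im)
    set c : ℝ := (x ^ ((ρ : ℂ).re - 1 / 2) + x ^ (-((ρ : ℂ).re - 1 / 2))) / 2 with hc_def
    have hmt : 0 ≤ (riemannZetaZeroOrder (ρ : ℂ) : ℝ) / (ρ : ℂ).im ^ 2 := div_nonneg hm hγ
    by_cases hTρ : T < |(ρ : ℂ).im|
    · rw [if_pos hTρ, if_pos hTρ]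
      have ekey : ∀ C : ℝ, (riemannZetaZeroOrder (ρ : ℂ) : ℝ) * C / (ρ : ℂ).im ^ 2 =
          C * ((riemannZetaZeroOrder (ρ : ℂ) : ℝ) / (ρ : ℂ).im ^ 2) := fun C => by ring
      rw [ekey]
      by_cases hβ : (0.9 : ℝ) ≤ (ρ : ℂ).re
      · have hβ' : ¬ (ρ : ℂ).re ≤ 0.1 := fun h => by linarith
        rw [if_pos ⟨hTρ, hβ⟩, if_neg (fun h => hβ' h.2), add_zero]
        have h1 : c * ((riemannZetaZeroOrder (ρ : ℂ) : ℝ) / (ρ : ℂ).im ^ 2) ≤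
            B * ((riemannZetaZeroOrder (ρ : ℂ) : ℝ) / (ρ : ℂ).im ^ 2) := mul_le_mul_of_nonneg_right (hpairB ρ) hmt
        nlinarith [mul_nonneg hA0 hmt]
      by_cases hβ2 : (ρ : ℂ).re ≤ 0.1
      · rw [if_neg (fun h => hβ h.2), if_pos ⟨hTρ, hβ2⟩, zero_add]
        have h1 : c * ((riemannZetaZeroOrder (ρ : ℂ) : ℝ) / (ρ : ℂ).im ^ 2) ≤
            B * ((riemannZetaZeroOrder (ρ : ℂ) : ℝ) / (ρ : ℂ).im ^ 2) := mul_le_mul_of_nonneg_right (hpairB ρ) hmt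
        nlinarith [mul_nonneg hA0 hmt]
      · rw [if_neg (fun h => hβ h.2), if_neg (fun h => hβ2 h.2), add_zero, mul_zero, add_zero]
        rw [not_le] at hβ hβ2
        exact mul_le_mul_of_nonneg_right (hpairA ρ hβ2 hβ) hmt
    · rw [if_neg hTρ, if_neg hTρ, if_neg (fun h => hTρ h.1), if_neg (fun h => hTρ h.1)]
      simp
  have hnn : ∀ ρ : RHWave0.riemannZetaNontrivialZeros,
      0 ≤ (if T < |(ρ : ℂ).im| then
          (riemannZetaZeroOrder (ρ : ℂ) : ℝ) * ((x ^ ((ρ : ℂ).re - 1 / 2) + x ^ (-((ρ : ℂ).re - 1 / 2))) / 2) /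
            (ρ : ℂ).im ^ 2 else 0) := by
    intro ρ
    split_ifs
    · exact div_nonneg (mul_nonneg (zeroOrder_nonneg' ρ) (by positivity)) (sq_nonneg _)
    · exact le_rfl
  have hS' : Summable (fun ρ => A * tail ρ + B * (dens ρ + densR ρ)) :=
    (hStail.mul_left A).add ((hSdens.add hSdensR).mul_left B)
  have hS := hS'.of_nonneg_of_le hnn hpt
  have h2B : B * (2 * (16 / 7 * (2600 / (T * √T)))) = (√x + (√x)⁻¹) * (16 / 7 * (2600 / (T * √T))) := by
    rw [hB_def]; ring
  calc ∑' ρ : RHWave0.riemannZetaNontrivialZeros,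
        (if T < |(ρ : ℂ).im| then
          (riemannZetaZeroOrder (ρ : ℂ) : ℝ) * ((x ^ ((ρ : ℂ).re - 1 / 2) + x ^ (-((ρ : ℂ).re - 1 / 2))) / 2) /
            (ρ : ℂ).im ^ 2 else 0)
      ≤ ∑' ρ, (A * tail ρ + B * (dens ρ + densR ρ)) := hS.tsum_le_tsum hpt hS'
    _ = A * ∑' ρ, tail ρ + B * (∑' ρ, dens ρ + ∑' ρ, densR ρ) := by
        rw [(hStail.mul_left A).tsum_add ((hSdens.add hSdensR).mul_left B), tsum_mul_left, tsum_mul_left,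
          hSdens.tsum_add hSdensR]
    _ = A * ∑' ρ, tail ρ + B * (2 * ∑' ρ, dens ρ) := by rw [hdensR_sum_eq]; ring
    _ ≤ A * ((Real.log (T / (2 * π)) + 1) / (π * T) + (184 + 30 * Real.log T) / T ^ 2) +
          B * (2 * (16 / 7 * (2600 / (T * √T)))) :=
        add_le_add (mul_le_mul_of_nonneg_left htail_sum hA0)
          (mul_le_mul_of_nonneg_left (by linarith [hdens_sum]) hB0)
    _ = _ := by rw [h2B]

end Reflection

end Summit.RiemannHypothesis.RiemannHypothesis.Theorems.Splittings.RobinFiniteC1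

end
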